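import Literature.NumberTheory.Automorphic.AutomorphicFormsStable
import Literature.NumberTheory.Automorphic.HarishChandraDiracGL
import HarnessLib

/-!
# Borel–Jacquet 4.3 for `GL_n`: the named fact `automorphicForms_isStableSubmodule` of the `GL_n`
datum on Harish-Chandra's convolution identity alone

Topic `NumberTheory/Automorphic`; the `GL_n` companion of `AutomorphicFormsStable`. For the honest
datum `AutomorphyDatum.gl n K hcpt` of `GL_n` over a number field `K` the group part of
Borel–Jacquet 1979, 4.3 is in the tree unconditionally (`IsAutomorphicForm.rightTranslation_gl`,
`isAutomorphicForm_rightTranslation_ofK_gl`), and so are the two calculus facts of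
`ArchimedeanCalculus` (`isArchSmooth_lieDeriv_gl`, `applyFree_congr_gl`: `𝔤 = 𝔤𝔩_n(K_∞)` is the
full matrix algebra). By `automorphicForms_lieDeriv_mem_of` (`AutomorphicFormsStable`) the
`(𝔤, K_∞) × GL_n(𝔸_K^∞)`-stability of the space `𝒜(GL_n)` of automorphic forms — the instance
`automorphicForms_isStableSubmodule (AutomorphyDatum.gl n K hcpt)` of the general named fact of
`AutomorphicForms` — therefore rests exactly on the moderate growth of the Lie derivatives `X φ`
of automorphic forms, i.e. on Harish-Chandra's convolution identity:

* `automorphicForms_isStableSubmodule_gl_of_hasModerateGrowth_lieDeriv` :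
  `AutomorphicRepsGL.hasModerateGrowth_lieDeriv hcpt → automorphicForms_isStableSubmodule (gl n K hcpt)`;
* `automorphicForms_isStableSubmodule_gl_of_HC` : from `AutomorphicRepsGL.exists_convolution_eq_self hcpt`
  (Harish-Chandra 1966, Thm. 1; Borel 1997, 2.14: `φ = φ ∗ α`), via
  `AutomorphicRepsGL.hasModerateGrowth_lieDeriv_of_HC` (`HarishChandraStep2GL`);
* `automorphicForms_isStableSubmodule_gl_of_finiteDimensional` : from Harish-Chandra's admissibility
  theorem `AutomorphicRepsGL.exists_finiteDimensional_convolution_mem hcpt` (Borel 1972, Thm. 3.17),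
  the current trust base of the `GL_n` theory (`HarishChandraDiracGL`).

The regularity hypothesis `(AutomorphyDatum.gl n K hcpt).IsRegular` inside the fact is not used
(the `GL_n` files certify translates of automorphic forms directly). Everything here is proved; no
definitions, no named facts.

## References

* A. Borel, H. Jacquet, *Automorphic forms and automorphic representations*, Proc. Sympos. Pure
  Math. 33 (Corvallis 1977), Part 1 (1979), 189–202, 4.3 [BorelJacquetCorvallis1979].
* A. Borel, *Représentations de groupes localement compacts*, LNM 276 (1972), Thm. 3.17–3.18
  [Borel1972].
* A. Borel, *Automorphic forms on `SL₂(ℝ)`* (1997), 2.14, 5.6 [Borel1997].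
-/

noncomputable section

open scoped MatrixGroups Classical
open NumberField NumberField.mixedEmbedding IsDedekindDomain

namespace Literature.NumberTheory.Automorphic

variable {n : ℕ} {K : Type} [Field K] [NumberField K] {hcpt : isCompact_glFiniteIntegralLevel n K}

/-- **Borel–Jacquet 4.3 for `GL_n` from the moderate growth of Lie derivatives**: if `X φ` has
moderate growth for every automorphic form `φ` on `GL_n(𝔸_K)` and every `X ∈ 𝔤𝔩_n(K_∞)` (the named
fact `AutomorphicRepsGL.hasModerateGrowth_lieDeriv hcpt`, Harish-Chandra), then the space of
automorphic forms of the `GL_n` datum is `(𝔤, K_∞) × GL_n(𝔸_K^∞)`-stable: translates by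
`GL_n(𝔸_K^∞)` (`IsAutomorphicForm.rightTranslation_gl`) and `K_∞`
(`isAutomorphicForm_rightTranslation_ofK_gl`) of automorphic forms are automorphic forms, and the
`𝔤`-part is `automorphicForms_lieDeriv_mem_of` with the `GL_n` discharges `isArchSmooth_lieDeriv_gl`,
`applyFree_congr_gl` of the calculus facts. Borel–Jacquet 1979, 4.3. [cite: BorelJacquetCorvallis1979, 4.3] -/
theorem automorphicForms_isStableSubmodule_gl_of_hasModerateGrowth_lieDeriv
    (h₁ : AutomorphicRepsGL.hasModerateGrowth_lieDeriv hcpt) :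
    automorphicForms_isStableSubmodule (AutomorphyDatum.gl n K hcpt) := by
  intro _ _
  exact
    { le_automorphicForms := le_rfl
      finite_stable := fun y hy => Submodule.span_le.2 fun φ hφ => by
        rw [SetLike.mem_coe, Submodule.mem_comap]
        exact (IsAutomorphicForm.rightTranslation_gl hφ hy).mem_automorphicForms
      k_stable := fun k => Submodule.span_le.2 fun φ hφ => by
        rw [SetLike.mem_coe, Submodule.mem_comap]
        exact (isAutomorphicForm_rightTranslation_ofK_gl hφ k).mem_automorphicForms
      lie_stable := fun X _ hφ =>
        automorphicForms_lieDeriv_mem_of (isArchSmooth_lieDeriv_gl hcpt) (applyFree_congr_gl hcpt)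
          (fun φ hφ X => h₁ φ hφ X) X hφ }

/-- **Borel–Jacquet 4.3 for `GL_n` on Harish-Chandra's convolution identity**
(`AutomorphicRepsGL.exists_convolution_eq_self hcpt`: `φ = φ ∗ α` with `α ∈ C_c^∞(GL_n(K_∞))`;
Harish-Chandra 1966, Thm. 1; Borel 1997, 2.14 and 5.6 (c)): then `X φ = φ ∗ α'` has moderate growth
(`AutomorphicRepsGL.hasModerateGrowth_lieDeriv_of_HC`) and the previous theorem applies.
Borel–Jacquet 1979, 4.3. [cite: BorelJacquetCorvallis1979, 4.3] -/
theorem automorphicForms_isStableSubmodule_gl_of_HC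
    (hHC : AutomorphicRepsGL.exists_convolution_eq_self hcpt) :
    automorphicForms_isStableSubmodule (AutomorphyDatum.gl n K hcpt) :=
  automorphicForms_isStableSubmodule_gl_of_hasModerateGrowth_lieDeriv
    (AutomorphicRepsGL.hasModerateGrowth_lieDeriv_of_HC hHC)

/-- **Borel–Jacquet 4.3 for `GL_n` on Harish-Chandra's admissibility theorem** (Borel 1972,
Thm. 3.17, the tree's named fact `AutomorphicRepsGL.exists_finiteDimensional_convolution_mem hcpt`,
from which the convolution identity follows, `exists_convolution_eq_self_of_finiteDimensional`):
the `(𝔤, K_∞) × GL_n(𝔸_K^∞)`-stability of `𝒜(GL_n)` on the current trust base of the `GL_n` theory.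
Borel–Jacquet 1979, 4.3; Borel 1972, Thm. 3.17–3.18. [cite: BorelJacquetCorvallis1979, 4.3] -/
theorem automorphicForms_isStableSubmodule_gl_of_finiteDimensional
    (h : AutomorphicRepsGL.exists_finiteDimensional_convolution_mem hcpt) :
    automorphicForms_isStableSubmodule (AutomorphyDatum.gl n K hcpt) :=
  automorphicForms_isStableSubmodule_gl_of_hasModerateGrowth_lieDeriv
    (AutomorphicRepsGL.hasModerateGrowth_lieDeriv_of_finiteDimensional h)

end Literature.NumberTheory.Automorphic
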